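import Mathlib.Topology.MetricSpace.Congruence
import Mathlib.Analysis.InnerProductSpace.Projection.FiniteDimensional
import Literature.Geometry.DiscreteGeometry.FejesTothKissingTwelve
import Literature.Barriers.AtomisticToContinuum.IcosahedralClusters
import HarnessLib

/-!
# Barrier: in the sticky limit, three-dimensional ground states are degenerate and include
# non-close-packed (polytetrahedral) clusters — already six balls

Topic: `Literature/Barriers/AtomisticToContinuum` (barrier catalogue of
`AtomisticToContinuum/Crystallization`, D-0021; seat 2). Conventions of
`FejesTothKissingTwelve.lean` / `KissingPatterns.lean`: balls of radius `1`, contact at distance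
`2` (`IsUnitBallPacking`, `contactGraph`), integer models `intVec`, `sqNormInt`; scaled integer
configurations `intConfig` and `dist_intConfig` are reused from `IcosahedralClusters.lean`;
congruence of labelled clusters is Mathlib's `Congruent`, taken up to relabelling
(`IsRelabelledCongruent`).

## The obstruction, as printed

For hard spheres with a short-range attraction "the total potential energy of a cluster is
linearly proportional to the number of contacts. Multiple ground states are therefore possible"
(Arkus–Manoharan–Brenner 2009, p. 1); "Up to `n = 9` every packing has exactly `3n - 6`
contacts, so that all packings have the same potential energy … for `n ≤ 9` the ground state
degeneracy increases exponentially" (p. 2); "icosahedra are not energy minima for hard-sphere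
clusters … the cluster behavior of attractive hard spheres could be qualitatively different from
that of many other potentials, including Lennard-Jones" (p. 3). Hoy–Harwayne-Gidansky–O'Hern
2012 (exact enumeration for `N ≤ 11`): "Minimal energy (maximally contacting) packings are not
necessarily either the most compact or symmetric … While many of these stable packings correspond
to 'on-pathway' nuclei possessing structural order consistent with the bulk (Barlow-ordered)
crystalline phase, many do not. The latter correspond to 'off-pathway' nuclei possessing
structural motifs incompatible with Barlow order, such as 5-fold-symmetries, stacking faults, and
twin defects … The fraction of isostatic nuclei possessing non-Barlow order grows rapidly with
increasing `N` to nearly 95% for `N = 11`" (abstract, p. 3); "The simplest stack-faulted motif is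
the `M = 6`, `M_c = 12` capped trigonal bipyramid structure" (§III D, p. 15), counted by
`f_ctb` among the "four independent measures of 'bad' nuclei that are inconsistent with LRCO"
(long-range crystalline order) (p. 15); the crossover size beyond which maximal contacts and
crystalline (fcc) order agree satisfies `N* > 11` (p. 12). Contrast `d = 2`: sticky-disc ground
states are subsets of the triangular lattice for every `N` (Heitmann–Radin 1980).

## What is PROVED here (`StickySphereClusters_holds`)

Two packings of six unit balls with the maximal-for-rigidity contact number `3·6 - 6 = 12`:

* `octahedralSix` — the regular octahedron of edge `2` (the octahedral hole of fcc AND hcp: a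
  Barlow motif), contacts `12`, the three remaining pairs at distance `2√2`;
* `cappedBipyramidSix` — the capped trigonal bipyramid / polytetrahedron: a regular tetrahedron,
  the reflection of one vertex in the opposite face, and the reflection of a second vertex in a
  face of the new tetrahedron (rational coordinates `(0,0,0), (1,1,0), (1,0,1), (0,1,1),
  (4/3,4/3,4/3), (5/9,5/9,20/9)` scaled by `√2`), contacts `12`, three tetrahedra
  `{0,1,2,3}, {1,2,3,4}, {2,3,4,5}` pairwise sharing a face, remaining pairs at distances
  `2√(8/3)` (twice) and `10/3`;
* both are unit-ball packings with the same contact number, and they are NOT congruent (their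
  diameters differ: `10/3 > 2√2`), so the sticky six-ball problem has two geometrically distinct
  minimisers, one of which carries the face-sharing-tetrahedra ("stack-faulted", Hoy et al.)
  motif. That `12` is the maximum for six balls and that these two are ALL the maximisers (among
  clusters with at least three contacts per ball, the sources' standing rigidity condition) is
  the enumeration result, vendored as the named fact `ArkusHoy_sixSpheres` (not re-proved).

## Sources

* N. Arkus, V. N. Manoharan, M. P. Brenner, *Minimal energy clusters of hard spheres with short
  range attractions*, Phys. Rev. Lett. 103 (2009) 118303, pp. 1–3 and note [23].
* R. S. Hoy, J. Harwayne-Gidansky, C. S. O'Hern, *Structure of finite sphere packings via exact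
  enumeration: implications for colloidal crystal nucleation*, Phys. Rev. E 85 (2012) 051403,
  arXiv:1202.5208: abstract (p. 3), §III (pp. 10–12), §III D (p. 15), §IV (p. 18).
* R. C. Heitmann, C. Radin, J. Stat. Phys. 22 (1980) 281 (the two-dimensional contrast).

## Wording risks

* "Ground state" for sticky spheres = maximal contact number among packings (Arkus p. 1); the
  maximality `12` for `n = 6` and the completeness of the list {octahedron, capped trigonal
  bipyramid} rest on the enumerations of Arkus et al. (analytic distance solutions, with the
  round-off caveat of their note [23]) and Hoy et al. (exact enumeration, `N ≤ 11`): a NAMED FACT,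
  stated — as printed — for clusters in which every ball has at least three contacts (Arkus p. 1,
  Hoy p. 4 condition (i)); the bridge to arbitrary six-ball packings IS formalised
  (`no_five_pairwise_dist_two`: no five points of `ℝ³` are pairwise at distance `2`, by a Gram
  matrix / dimension count; `contactNumber_le_eleven_of_contactsAt_le_two`;
  `ArkusHoy_sixSpheres.unrestricted`).
* Non-embeddability of the face-sharing tetrahedra chain in Barlow packings is cited (Hoy et al.,
  "inconsistent with LRCO"), not formalised; formalised is the chain itself.
-/

noncomputable section

open Finset

namespace Literature.Barriers.AtomisticToContinuum

/-- Euclidean `3`-space. -/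
local notation "E3" => EuclideanSpace ℝ (Fin 3)

/-! ### Scaled integer models (reused from `IcosahedralClusters.lean`) and contact counting -/

open AtomisticToContinuum (intConfig dist_intConfig)

/-- At the scale `t = 2/√m` (`m > 0`) the distance of `i, j` in the scaled integer model
`intConfig c t` (`i ↦ t · c(i)`, `IcosahedralClusters.lean`) is `2 √(n_ij / m)`; in particular it
is `2` iff `n_ij = m`, and `≥ 2` iff `n_ij ≥ m`. [folklore] -/
theorem dist_intConfig_sqrt {N : ℕ} (c : Fin N → Fin 3 → ℤ) {m : ℕ} (hm : 0 < m)
    (i j : Fin N) :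
    dist (intConfig c (2 / Real.sqrt m) i) (intConfig c (2 / Real.sqrt m) j) =
      2 * Real.sqrt ((Literature.Geometry.DiscreteGeometry.sqNormInt (c i - c j) : ℝ) / m) := by
  have hm' : (0 : ℝ) < Real.sqrt m := Real.sqrt_pos.2 (by exact_mod_cast hm)
  rw [dist_intConfig, abs_of_pos (by positivity), Real.sqrt_div' _ (Nat.cast_nonneg m)]
  ring

/-- **The contact number** of a finite configuration of centres of unit balls: the number of
pairs `i < j` at distance exactly `2` ("`A_ij = 1` if the `i`th and `j`th particles touch"; the
sticky energy is minus this number). [cite: ArkusManoharanBrenner2009, p. 1] -/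
def contactNumber {N : ℕ} (x : Fin N → E3) : ℕ := by
  classical
  exact ((univ : Finset (Fin N × Fin N)).filter fun p => p.1 < p.2 ∧ dist (x p.1) (x p.2) = 2).card

/-- Integer shadow: pairs `i < j` with `n_ij = m`. [folklore] -/
def intContactNumber {N : ℕ} (c : Fin N → Fin 3 → ℤ) (m : ℤ) : ℕ :=
  ((univ : Finset (Fin N × Fin N)).filter fun p => p.1 < p.2 ∧ Literature.Geometry.DiscreteGeometry.sqNormInt (c p.1 - c p.2) = m).card

/-- Contact counting reduces to integer arithmetic at the scale `2/√m`. [folklore] -/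
theorem contactNumber_scaled {N : ℕ} (c : Fin N → Fin 3 → ℤ) {m : ℕ} (hm : 0 < m) :
    contactNumber (intConfig c (2 / Real.sqrt m)) = intContactNumber c m := by
  classical
  unfold contactNumber intContactNumber
  congr 1
  refine Finset.filter_congr fun p _ => ?_
  rw [dist_intConfig_sqrt c hm]
  have h0 : (0 : ℝ) ≤ (Literature.Geometry.DiscreteGeometry.sqNormInt (c p.1 - c p.2) : ℝ) := sqNormInt_nonneg _
  have hmR : (0 : ℝ) < m := by exact_mod_cast hm
  constructor
  · rintro ⟨hlt, hd⟩
    refine ⟨hlt, ?_⟩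
    have h1 : Real.sqrt ((Literature.Geometry.DiscreteGeometry.sqNormInt (c p.1 - c p.2) : ℝ) / m) = 1 := by linarith
    rw [Real.sqrt_eq_one, div_eq_one_iff_eq hmR.ne'] at h1
    exact_mod_cast h1
  · rintro ⟨hlt, hn⟩
    refine ⟨hlt, ?_⟩
    rw [hn]; push_cast; rw [div_self hmR.ne', Real.sqrt_one]; ring

/-- A scaled integer model whose distinct points are at integer squared distance `≥ m` is a
packing of unit balls at the scale `2/√m`. [folklore] -/
theorem isUnitBallPacking_scaled {N : ℕ} (c : Fin N → Fin 3 → ℤ) {m : ℕ} (hm : 0 < m)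
    (hsep : ∀ i j, i ≠ j → (m : ℤ) ≤ Literature.Geometry.DiscreteGeometry.sqNormInt (c i - c j)) :
    Literature.Geometry.DiscreteGeometry.IsUnitBallPacking (Set.range (intConfig c (2 / Real.sqrt m))) := by
  rintro _ ⟨i, rfl⟩ _ ⟨j, rfl⟩ hd
  by_contra hne
  have hij : i ≠ j := fun h => hne (h ▸ rfl)
  have h := hsep i j hij
  rw [dist_intConfig_sqrt c hm] at hd
  have hmR : (0 : ℝ) < m := by exact_mod_cast hm
  have h1 : (1 : ℝ) ≤ (Literature.Geometry.DiscreteGeometry.sqNormInt (c i - c j) : ℝ) / m := by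
    rw [le_div_iff₀ hmR, one_mul]; exact_mod_cast h
  have : (1 : ℝ) ≤ Real.sqrt ((Literature.Geometry.DiscreteGeometry.sqNormInt (c i - c j) : ℝ) / m) := by
    rw [show (1 : ℝ) = Real.sqrt 1 from Real.sqrt_one.symm]
    exact Real.sqrt_le_sqrt h1
  linarith

/-! ### The two six-ball clusters (integer models, contact at squared distance `162`) -/

/-- Integer model of the regular OCTAHEDRON of edge `√162` (vertices `±9 e_k`).
[cite: HoyHarwayneGidanskyOHern2012, §III (Barlow-ordered nuclei)] -/
def octaInt : Fin 6 → Fin 3 → ℤ :=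
  ![![9, 0, 0], ![-9, 0, 0], ![0, 9, 0], ![0, -9, 0], ![0, 0, 9], ![0, 0, -9]]

/-- Integer model (denominators cleared by `9`) of the CAPPED TRIGONAL BIPYRAMID: the regular
tetrahedron `9·{(0,0,0),(1,1,0),(1,0,1),(0,1,1)}`, the reflection `(12,12,12)` of its first vertex
in the opposite face, and the reflection `(5,5,20)` of `(9,9,0)` in the face
`{(9,0,9),(0,9,9),(12,12,12)}` — three regular tetrahedra in a face-sharing chain.
[cite: HoyHarwayneGidanskyOHern2012, §III D (p. 15, "capped trigonal bipyramid")] -/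
def ctbInt : Fin 6 → Fin 3 → ℤ :=
  ![![0, 0, 0], ![9, 9, 0], ![9, 0, 9], ![0, 9, 9], ![12, 12, 12], ![5, 5, 20]]

/-- **The octahedral six-ball cluster** (contact distance `2`). [folklore] -/
def octahedralSix : Fin 6 → E3 := intConfig octaInt (2 / Real.sqrt (162 : ℕ))

/-- **The capped-trigonal-bipyramid six-ball cluster** (contact distance `2`).
[cite: HoyHarwayneGidanskyOHern2012, §III D (p. 15)] -/
def cappedBipyramidSix : Fin 6 → E3 := intConfig ctbInt (2 / Real.sqrt (162 : ℕ))

/-- Twelve contacts in the octahedron. [folklore] -/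
theorem intContactNumber_octa : intContactNumber octaInt 162 = 12 := by decide +kernel

/-- Twelve contacts in the capped trigonal bipyramid. [cite: HoyHarwayneGidanskyOHern2012, §III D (p. 15, "M = 6, M_c = 12")] -/
theorem intContactNumber_ctb : intContactNumber ctbInt 162 = 12 := by decide +kernel

/-- Distinct octahedron points are at squared distance `≥ 162` (`162` or `324`). [folklore] -/
theorem sep_octa : ∀ i j : Fin 6, i ≠ j → (162 : ℤ) ≤ Literature.Geometry.DiscreteGeometry.sqNormInt (octaInt i - octaInt j) := by
  decide +kernel

/-- Distinct capped-bipyramid points are at squared distance `≥ 162` (`162`, `432` or `450`).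
[folklore] -/
theorem sep_ctb : ∀ i j : Fin 6, i ≠ j → (162 : ℤ) ≤ Literature.Geometry.DiscreteGeometry.sqNormInt (ctbInt i - ctbInt j) := by
  decide +kernel

/-- The face-sharing chain: `{0,1,2,3}`, `{1,2,3,4}`, `{2,3,4,5}` are regular tetrahedra of
squared edge `162` (all six edges of each are contacts). [cite: HoyHarwayneGidanskyOHern2012, §III D (p. 15)] -/
theorem tetrahedra_ctb :
    (∀ i j : Fin 6, i < j → j ≤ 3 → Literature.Geometry.DiscreteGeometry.sqNormInt (ctbInt i - ctbInt j) = 162) ∧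
    (∀ i j : Fin 6, 1 ≤ i → i < j → j ≤ 4 → Literature.Geometry.DiscreteGeometry.sqNormInt (ctbInt i - ctbInt j) = 162) ∧
    (∀ i j : Fin 6, 2 ≤ i → i < j → Literature.Geometry.DiscreteGeometry.sqNormInt (ctbInt i - ctbInt j) = 162) := by
  refine ⟨?_, ?_, ?_⟩ <;> decide +kernel

/-- The capped bipyramid has a pair (`0` and `5`) at squared distance `450 = (25/9)·162`, i.e.
physical distance `10/3`; all octahedron pairs are at squared distance `≤ 324 = 2·162`
(physical `≤ 2√2`). [folklore] -/
theorem diam_ctb_octa :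
    Literature.Geometry.DiscreteGeometry.sqNormInt (ctbInt 0 - ctbInt 5) = 450 ∧ ∀ i j : Fin 6, Literature.Geometry.DiscreteGeometry.sqNormInt (octaInt i - octaInt j) ≤ 324 := by
  refine ⟨by decide +kernel, by decide +kernel⟩

/-! ### The geometric statements -/

/-- Both clusters are packings of unit balls. [folklore] -/
theorem isUnitBallPacking_octahedralSix : Literature.Geometry.DiscreteGeometry.IsUnitBallPacking (Set.range octahedralSix) :=
  isUnitBallPacking_scaled octaInt (by norm_num) sep_octa

/-- [folklore] -/
theorem isUnitBallPacking_cappedBipyramidSix : Literature.Geometry.DiscreteGeometry.IsUnitBallPacking (Set.range cappedBipyramidSix) :=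
  isUnitBallPacking_scaled ctbInt (by norm_num) sep_ctb

/-- Both clusters have twelve contacts (`3n - 6`, the minimal-rigidity count).
[cite: ArkusManoharanBrenner2009, p. 2 ("Up to n = 9 every packing has exactly 3n − 6 contacts")] -/
theorem contactNumber_six :
    contactNumber octahedralSix = 12 ∧ contactNumber cappedBipyramidSix = 12 := by
  refine ⟨?_, ?_⟩
  · rw [octahedralSix, contactNumber_scaled octaInt (by norm_num : 0 < 162)]
    exact_mod_cast intContactNumber_octa
  · rw [cappedBipyramidSix, contactNumber_scaled ctbInt (by norm_num : 0 < 162)]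
    exact_mod_cast intContactNumber_ctb

/-- **`x` and `y` are congruent up to relabelling**: for some permutation `σ` of the labels,
`x` and `y ∘ σ` are congruent in Mathlib's sense (`Congruent`: all corresponding pair distances
agree; equivalently an isometry of `ℝ³` maps one labelled cluster onto the other). This is Hoy et
al.'s notion of one "macrostate": "defined by a unique set of `N(N − 1)/2` squared interparticle
distances `{r²_ij}`" up to "permutations of particle indices".
[cite: HoyHarwayneGidanskyOHern2012, §II (p. 4)] -/
def IsRelabelledCongruent {N : ℕ} (x y : Fin N → E3) : Prop :=
  ∃ σ : Equiv.Perm (Fin N), Congruent x (y ∘ σ)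

/-- Unfolding: some relabelling matches all pair distances. [folklore] -/
theorem isRelabelledCongruent_iff {N : ℕ} (x y : Fin N → E3) :
    IsRelabelledCongruent x y ↔
      ∃ σ : Equiv.Perm (Fin N), ∀ i j, dist (x i) (x j) = dist (y (σ i)) (y (σ j)) := by
  simp only [IsRelabelledCongruent, congruent_iff_dist_eq, Function.comp_apply]

/-- **The two six-ball clusters are not congruent**: the capped bipyramid has diameter `10/3`,
the octahedron `2√2 < 10/3`. [folklore] -/
theorem not_congruent_six : ¬ IsRelabelledCongruent cappedBipyramidSix octahedralSix := by
  rw [isRelabelledCongruent_iff]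
  rintro ⟨σ, hσ⟩
  have h := hσ 0 5
  rw [cappedBipyramidSix, octahedralSix, dist_intConfig_sqrt ctbInt (by norm_num : 0 < 162),
    dist_intConfig_sqrt octaInt (by norm_num : 0 < 162), diam_ctb_octa.1] at h
  have hle := diam_ctb_octa.2 (σ 0) (σ 5)
  have hle' : (Literature.Geometry.DiscreteGeometry.sqNormInt (octaInt (σ 0) - octaInt (σ 5)) : ℝ) / (162 : ℕ) ≤ 2 := by
    rw [div_le_iff₀ (by norm_num)]
    have : (Literature.Geometry.DiscreteGeometry.sqNormInt (octaInt (σ 0) - octaInt (σ 5)) : ℝ) ≤ 324 := by exact_mod_cast hle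
    push_cast; linarith
  have h2 : Real.sqrt ((Literature.Geometry.DiscreteGeometry.sqNormInt (octaInt (σ 0) - octaInt (σ 5)) : ℝ) / (162 : ℕ)) ≤ Real.sqrt 2 :=
    Real.sqrt_le_sqrt hle'
  have h3 : Real.sqrt (((450 : ℤ) : ℝ) / (162 : ℕ)) = 5 / 3 := by
    rw [Real.sqrt_eq_iff_mul_self_eq (by norm_num) (by norm_num)]; norm_num
  have h4 : Real.sqrt 2 < 5 / 3 := by
    rw [Real.sqrt_lt' (by norm_num)]; norm_num
  rw [h3] at h
  linarith

/-! ### The named fact (enumeration) and the barrier -/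

/-- The number of contacts of the `i`th ball (other centres at distance exactly `2`).
[cite: HoyHarwayneGidanskyOHern2012, §II (p. 4, condition (i))] -/
def contactsAt {N : ℕ} (x : Fin N → E3) (i : Fin N) : ℕ := by
  classical
  exact ((univ : Finset (Fin N)).filter fun j => j ≠ i ∧ dist (x i) (x j) = 2).card

/-- NAMED FACT — **six sticky spheres (Arkus–Manoharan–Brenner 2009; Hoy et al. 2012, exact
enumeration)**, with the sources' standing restriction to clusters satisfying the minimal
rigidity condition "(i) each particle possesses at least 3 contacts" (Arkus: "minimal rigidity
constraints (`≥ 3` contacts per particle, `≥ 3n − 6` total contacts)"; Hoy: "clusters … wherein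
each sphere possesses at least 3 contacts"): among packings of six unit balls in `ℝ³` in which
every ball has at least three contacts, the contact number is at most `N_c^max(6) = 12`, and
"`M(6, 12) = 2` since exactly two six-particle macrostates exist for systems with
`N_c = N_c^max(6) = 12` (Fig. 1)": the octahedron and the capped trigonal bipyramid.
(Bridge to arbitrary six-ball packings, PROVED below as `ArkusHoy_sixSpheres.unrestricted`: a
ball with `≤ 2` contacts caps the total at `11`, since `10` contacts among the other five would
be five mutually touching unit balls, impossible in `ℝ³` — `no_five_pairwise_dist_two`; for
general `N`, `N_c^max(N)` is the open three-dimensional unit-distance problem, Hoy p. 2.) [cite: HoyHarwayneGidanskyOHern2012, §II (p. 4: "M(6,12) = 2 … N_c^max(6) = 12 (Fig. 1)", conditions (i)–(ii))]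
[cite: ArkusManoharanBrenner2009, pp. 1–2 and Fig. 1] -/
def ArkusHoy_sixSpheres : Prop :=
  ∀ z : Fin 6 → EuclideanSpace ℝ (Fin 3), Function.Injective z →
    Literature.Geometry.DiscreteGeometry.IsUnitBallPacking (Set.range z) → (∀ i, 3 ≤ contactsAt z i) →
      contactNumber z ≤ 12 ∧
        (contactNumber z = 12 →
          IsRelabelledCongruent z octahedralSix ∨ IsRelabelledCongruent z cappedBipyramidSix)

/-- **BARRIER (AtomisticToContinuum / Crystallization): the sticky (contact-counting) limit in
`ℝ³` has degenerate finite ground states including non-close-packed, polytetrahedral clusters —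
for six balls the octahedron (a Barlow motif) and the capped trigonal bipyramid (three
face-sharing tetrahedra, "the simplest stack-faulted motif") tie at twelve contacts.** The
technique class stopped: transplanting the two-dimensional sticky-limit programme — exact
finite-`N` ground states of the contact-counting energy are lattice (close-packing) fragments,
from which soft potentials are reached perturbatively (Heitmann–Radin; Theil; De Luca–Friesecke) —
to `d = 3` as a route to `Literature.StatMech.IsCrystallizing lennardJones 3`.

* technique_class: sticky-limit-exactness contact-number-maximisation finite-N-sticky-ground-states heitmann-radin-transplant-3d brittle-limit-perturbation close-packed-fragment-ansatz
* blocks: the `d = 3` analogue of "sticky-disc ground states are subsets of the triangular lattice for every `N`" [cite: HeitmannRadin1980, Theorem]: for six sticky balls two non-congruent packings attain the contact number `12` (this file, `StickySphereClusters_holds`), all minimally rigid packings with `n ≤ 9` have exactly `3n - 6` contacts and "the ground state degeneracy increases exponentially" [cite: ArkusManoharanBrenner2009, p. 2], and among the maximal-contact and isostatic packings for `N ≤ 11` many possess "structural motifs incompatible with Barlow order, such as 5-fold-symmetries, stacking faults, and twin defects", up to "nearly 95% for `N = 11`" of isostatic nuclei [cite: HoyHarwayneGidanskyOHern2012, abstract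 (p. 3) and §IV (p. 18)]
* because: the sticky energy is minus the number of contacts [cite: ArkusManoharanBrenner2009, p. 1]; reflecting a vertex of a regular tetrahedron in the opposite face keeps all edge lengths, so chains of face-sharing tetrahedra reach `3n - 6` contacts as fast as octahedral (close-packed) growth does — here the chain `{0,1,2,3}, {1,2,3,4}, {2,3,4,5}` (`tetrahedra_ctb`); the capped trigonal bipyramid is "the simplest stack-faulted motif", counted among the measures of nuclei "inconsistent with LRCO" [cite: HoyHarwayneGidanskyOHern2012, §III D (p. 15)]; maximal contacts and maximal density / symmetry part ways for `N ≤ 11`, with the crossover `N* > 11` [cite: HoyHarwayneGidanskyOHern2012, §III (p. 12)]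
* evasions_known: (i) larger `n`: at `n = 10, 11, 12` the maximal-contact packings are hcp subunits and "the stability of HCP-like clusters at small `n` may influence the nucleation of colloidal crystals" [cite: ArkusManoharanBrenner2009, pp. 2–3]; the unique `N = 11` sticky ground state has `29` contacts and hcp order [cite: HoyHarwayneGidanskyOHern2012, §III (p. 12)]; (ii) `d = 2`, where the sticky limit IS rigid [cite: HeitmannRadin1980, Theorem]; (iii) the asymptotic conjecture tolerates finite-`N` degeneracy (local limits along subsequences) [cite: BlancLewin2015, §2.1 (15)–(17)]
* scope_caveats: proved here: two explicit non-congruent six-ball packings with `12` contacts, one a Barlow motif (octahedron) and one containing a face-sharing chain of three regular tetrahedra; NOT proved in THIS file: that `12` is maximal for six balls and that these are the only maximisers (named fact `ArkusHoy_sixSpheres`, stated with the sources' proviso of at least three contacts per ball and extended to all six-ball packings by the proved lemma `no_five_pairwise_dist_two`; from enumerations whose completeness the authors qualify [cite: ArkusManoharanBrenner2009, note 23]) — since DISCHARGED in `StickySphereClustersProofs.lean` (`ArkusHoy_sixSpheres_holds`, an elementary proof using neither proviso), so that `C(6) = 12` with exactly two maximisers is a theorem of the tree; nor the non-embeddability of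 the tetrahedra chain in Barlow packings (cited [cite: HoyHarwayneGidanskyOHern2012, §III D (p. 15)]); nothing is claimed for Lennard-Jones itself, whose small clusters behave differently again (icosahedra) [cite: ArkusManoharanBrenner2009, p. 3]; (audit 2026-08-15) the technique-class tokens `sticky-limit-exactness`, `contact-number-maximisation`, `brittle-limit-perturbation` and `close-packed-fragment-ansatz` above are wider than what the six-ball tie obstructs: it refutes only the STRUCTURE half of a Heitmann–Radin transplant ("every maximiser is a close-packing fragment, for every `N`"), while the ENERGY half holds at six balls (the octahedron is maximal among all six-ball packings) and on every enumeration in print (`n ≤ 19`), the local per-shell programme (`≤ 24` tangencies in a kissing shell [cite: FlatleyEtAl2013, Theorem]; kissing-twelve packings are layer stackings [cite: Hales2012, Theorem 1]) is untouched, any pair potential strictly increasing beyond contact makes the octahedron strictly better than the capped bipyramid, and non-Barlow maximisers recur at `n = 13, 15, 16, 19` [cite: HolmesCerfon2016, §3] (so evasion (i) is not monotone in `n`) — see `StickySphereClustersNarrow` (`StickySphereClustersNarrow.lean`), which implies this block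
* status: established (theorem `StickySphereClusters_holds` for the degeneracy; enumeration results of Arkus et al. 2009 and Hoy et al. 2012 for maximality and statistics)

[cite: ArkusManoharanBrenner2009, pp. 1–2] [cite: HoyHarwayneGidanskyOHern2012, abstract and §III D (p. 15)] -/
def StickySphereClusters : Prop :=
  Literature.Geometry.DiscreteGeometry.IsUnitBallPacking (Set.range octahedralSix) ∧ Literature.Geometry.DiscreteGeometry.IsUnitBallPacking (Set.range cappedBipyramidSix) ∧
    contactNumber octahedralSix = 12 ∧ contactNumber cappedBipyramidSix = 12 ∧
    ¬ IsRelabelledCongruent cappedBipyramidSix octahedralSix ∧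
    -- the face-sharing chain of three regular tetrahedra in the capped bipyramid
    (∀ i j : Fin 6, 2 ≤ i → i < j → dist (cappedBipyramidSix i) (cappedBipyramidSix j) = 2) ∧
    (∀ i j : Fin 6, i < j → j ≤ 3 → dist (cappedBipyramidSix i) (cappedBipyramidSix j) = 2) ∧
    (∀ i j : Fin 6, 1 ≤ i → i < j → j ≤ 4 → dist (cappedBipyramidSix i) (cappedBipyramidSix j) = 2)

/-- Contacts of the capped bipyramid from the integer table. [folklore] -/
theorem dist_cappedBipyramidSix_eq_two {i j : Fin 6} (h : Literature.Geometry.DiscreteGeometry.sqNormInt (ctbInt i - ctbInt j) = 162) :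
    dist (cappedBipyramidSix i) (cappedBipyramidSix j) = 2 := by
  rw [cappedBipyramidSix, dist_intConfig_sqrt ctbInt (by norm_num : 0 < 162), h]
  push_cast
  rw [div_self (by norm_num : (162 : ℝ) ≠ 0), Real.sqrt_one]
  ring

/-- **Proof of the barrier.** [cite: HoyHarwayneGidanskyOHern2012, §III D (p. 15)] -/
theorem StickySphereClusters_holds : StickySphereClusters := by
  refine ⟨isUnitBallPacking_octahedralSix, isUnitBallPacking_cappedBipyramidSix, contactNumber_six.1,
    contactNumber_six.2, not_congruent_six, ?_, ?_, ?_⟩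
  · exact fun i j hi hij => dist_cappedBipyramidSix_eq_two (tetrahedra_ctb.2.2 i j hi hij)
  · exact fun i j hij hj => dist_cappedBipyramidSix_eq_two (tetrahedra_ctb.1 i j hij hj)
  · exact fun i j hi hij hj => dist_cappedBipyramidSix_eq_two (tetrahedra_ctb.2.1 i j hi hij hj)

/-- Under the named fact, both clusters are sticky ground states among the minimally rigid
six-ball clusters: every competitor with at least three contacts per ball has at most their
contact number. [cite: ArkusManoharanBrenner2009, p. 2] -/
theorem ArkusHoy_sixSpheres.ground_states (h : ArkusHoy_sixSpheres) (z : Fin 6 → E3)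
    (hz : Function.Injective z) (hp : Literature.Geometry.DiscreteGeometry.IsUnitBallPacking (Set.range z)) (h3 : ∀ i, 3 ≤ contactsAt z i) :
    contactNumber z ≤ contactNumber octahedralSix ∧ contactNumber z ≤ contactNumber cappedBipyramidSix := by
  rw [contactNumber_six.1, contactNumber_six.2]
  exact ⟨(h z hz hp h3).1, (h z hz hp h3).1⟩


/-! ### Bridge to arbitrary six-ball packings: five mutually touching balls do not exist in `ℝ³` -/

/-- **No five points of `ℝ³` are pairwise at distance `2`**: the four difference vectors from one
of them have Gram matrix `2I + 2J`, which is positive definite, so they would be linearly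
independent in a `3`-dimensional space. [folklore] -/
theorem no_five_pairwise_dist_two (p : Fin 5 → E3) (h : ∀ i j, i ≠ j → dist (p i) (p j) = 2) :
    False := by
  set w : Fin 4 → E3 := fun i => p i.succ - p 0 with hw
  have hnorm : ∀ i, ‖w i‖ = 2 := fun i => by
    rw [hw]; dsimp only; rw [← dist_eq_norm]; exact h _ _ (Fin.succ_ne_zero i)
  have hsub : ∀ i j, i ≠ j → ‖w i - w j‖ = 2 := fun i j hij => by
    rw [hw]; dsimp only
    rw [show p i.succ - p 0 - (p j.succ - p 0) = p i.succ - p j.succ by abel, ← dist_eq_norm]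
    exact h _ _ (fun e => hij (Fin.succ_injective _ e))
  have hG : ∀ i j, inner ℝ (w i) (w j) = if i = j then (4 : ℝ) else 2 := by
    intro i j
    split_ifs with hij
    · subst hij; rw [real_inner_self_eq_norm_sq, hnorm]; norm_num
    · have e := norm_sub_sq_real (w i) (w j)
      rw [hsub i j hij, hnorm i, hnorm j] at e
      linarith
  have hli : LinearIndependent ℝ w := by
    rw [Fintype.linearIndependent_iff]
    intro g hg
    have key : ∀ j, inner ℝ (∑ i, g i • w i) (w j) = 0 := fun j => by rw [hg, inner_zero_left]
    have e : ∀ j, inner ℝ (∑ i, g i • w i) (w j) = ∑ i, g i * inner ℝ (w i) (w j) := fun j => by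
      rw [sum_inner]; simp [real_inner_smul_left]
    have h0 := key 0; have h1 := key 1; have h2 := key 2; have h3 := key 3
    rw [e] at h0 h1 h2 h3
    simp only [Fin.sum_univ_four, hG] at h0 h1 h2 h3
    simp (config := {decide := true}) only [if_true, if_false] at h0 h1 h2 h3
    intro i
    fin_cases i <;> simp <;> linarith
  have hcard := hli.fintype_card_le_finrank
  rw [finrank_euclideanSpace_fin, Fintype.card_fin] at hcard
  omega

/-- For each label `i : Fin 6` there are exactly `10` pairs `a < b` avoiding `i`. [folklore] -/
theorem card_pairs_avoiding (i : Fin 6) :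
    ((univ : Finset (Fin 6 × Fin 6)).filter fun p => p.1 < p.2 ∧ p.1 ≠ i ∧ p.2 ≠ i).card = 10 := by
  revert i; decide

/-- **A six-ball cluster with a ball having at most two contacts has at most `11` contacts**: at
most `2` contacts at that ball, and at most `9` among the other five (all `10` would be five
mutually touching balls, excluded by `no_five_pairwise_dist_two`). [folklore] -/
theorem contactNumber_le_eleven_of_contactsAt_le_two (z : Fin 6 → E3) {i : Fin 6}
    (hi : contactsAt z i ≤ 2) : contactNumber z ≤ 11 := by
  classical
  -- the set of contact pairs and its split according to whether `i` is involved
  set P : Finset (Fin 6 × Fin 6) :=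
    (univ : Finset (Fin 6 × Fin 6)).filter fun p => p.1 < p.2 ∧ dist (z p.1) (z p.2) = 2 with hP
  have hcn : contactNumber z = P.card := by
    unfold contactNumber; congr 1
  set A := P.filter fun p => p.1 = i ∨ p.2 = i with hA
  set B := P.filter fun p => ¬ (p.1 = i ∨ p.2 = i) with hB
  have hsplit : A.card + B.card = P.card := Finset.card_filter_add_card_filter_not _
  -- (a) pairs through `i` inject into the contacts at `i`
  set C : Finset (Fin 6) := (univ : Finset (Fin 6)).filter fun j => j ≠ i ∧ dist (z i) (z j) = 2
    with hC
  have hCi : contactsAt z i = C.card := by unfold contactsAt; congr 1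
  have hAle : A.card ≤ C.card := by
    refine Finset.card_le_card_of_injOn (fun p => if p.1 = i then p.2 else p.1) ?_ ?_
    · intro p hp
      simp only [hA, hP, Finset.mem_coe, Finset.mem_filter, Finset.mem_univ, true_and] at hp
      obtain ⟨⟨hlt, hd⟩, hor⟩ := hp
      simp only [hC, Finset.mem_coe, Finset.mem_filter, Finset.mem_univ, true_and]
      split_ifs with h1
      · subst h1; exact ⟨ne_of_gt hlt, hd⟩
      · rcases hor with h | h
        · exact absurd h h1
        · subst h; exact ⟨h1, by rw [dist_comm]; exact hd⟩
    · intro p hp q hq hpq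
      simp only [hA, hP, Finset.mem_coe, Finset.mem_filter, Finset.mem_univ, true_and] at hp hq
      obtain ⟨⟨hplt, -⟩, hpor⟩ := hp
      obtain ⟨⟨hqlt, -⟩, hqor⟩ := hq
      dsimp only at hpq
      split_ifs at hpq with h1 h2 h2
      · exact Prod.ext (h1.trans h2.symm) hpq
      · rcases hqor with h | h
        · exact absurd h h2
        · exfalso
          have a : i < p.2 := by rw [← h1]; exact hplt
          have b : q.1 < i := by rw [← h]; exact hqlt
          rw [← hpq] at b
          exact lt_irrefl _ (a.trans b)
      · rcases hpor with h | h
        · exact absurd h h1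
        · exfalso
          have a : p.1 < i := by rw [← h]; exact hplt
          have b : i < q.2 := by rw [← h2]; exact hqlt
          rw [← hpq] at b
          exact lt_irrefl _ (a.trans b)
      · rcases hpor with h | h
        · exact absurd h h1
        · rcases hqor with h' | h'
          · exact absurd h' h2
          · exact Prod.ext hpq (h.trans h'.symm)
  -- (b) pairs avoiding `i`: at most `9`
  set Q : Finset (Fin 6 × Fin 6) :=
    (univ : Finset (Fin 6 × Fin 6)).filter fun p => p.1 < p.2 ∧ p.1 ≠ i ∧ p.2 ≠ i with hQ
  have hBQ : B ⊆ Q := by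
    intro p hp
    simp only [hB, hP, Finset.mem_filter, Finset.mem_univ, true_and, not_or] at hp
    simp only [hQ, Finset.mem_filter, Finset.mem_univ, true_and]
    exact ⟨hp.1.1, hp.2.1, hp.2.2⟩
  have hQcard : Q.card = 10 := card_pairs_avoiding i
  have hBle : B.card ≤ 9 := by
    by_contra hlt
    have hle : Q.card ≤ B.card := by omega
    have hBQ' : B = Q := Finset.eq_of_subset_of_card_le hBQ hle
    -- every pair avoiding `i` is a contact: five mutually touching balls
    have hall : ∀ a b : Fin 6, a < b → a ≠ i → b ≠ i → dist (z a) (z b) = 2 := by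
      intro a b hab ha hb
      have hmem : (a, b) ∈ Q := by
        simp only [hQ, Finset.mem_filter, Finset.mem_univ, true_and]; exact ⟨hab, ha, hb⟩
      rw [← hBQ'] at hmem
      simp only [hB, hP, Finset.mem_filter, Finset.mem_univ, true_and] at hmem
      exact hmem.1.2
    refine no_five_pairwise_dist_two (fun k => z (i.succAbove k)) fun j k hjk => ?_
    have hne : i.succAbove j ≠ i.succAbove k := fun e => hjk (Fin.succAbove_right_injective e)
    rcases lt_or_gt_of_ne hne with hlt' | hgt
    · exact hall _ _ hlt' (Fin.succAbove_ne i j) (Fin.succAbove_ne i k)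
    · rw [dist_comm]; exact hall _ _ hgt (Fin.succAbove_ne i k) (Fin.succAbove_ne i j)
  -- conclusion
  rw [hcn, ← hsplit]
  have : A.card ≤ 2 := hAle.trans (hCi ▸ hi)
  omega

/-- **The named fact without the rigidity proviso**: under `ArkusHoy_sixSpheres`, EVERY packing
of six unit balls has at most `12` contacts, with equality only for the two macrostates — a ball
with `≤ 2` contacts caps the total at `11` (`contactNumber_le_eleven_of_contactsAt_le_two`).
[cite: HoyHarwayneGidanskyOHern2012, §II (p. 4)] -/
theorem ArkusHoy_sixSpheres.unrestricted (h : ArkusHoy_sixSpheres) (z : Fin 6 → E3)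
    (hz : Function.Injective z) (hp : Literature.Geometry.DiscreteGeometry.IsUnitBallPacking (Set.range z)) :
    contactNumber z ≤ 12 ∧
      (contactNumber z = 12 →
        IsRelabelledCongruent z octahedralSix ∨ IsRelabelledCongruent z cappedBipyramidSix) := by
  by_cases h3 : ∀ i, 3 ≤ contactsAt z i
  · exact h z hz hp h3
  · obtain ⟨i, hi⟩ := not_forall.1 h3
    have h11 := contactNumber_le_eleven_of_contactsAt_le_two z (Nat.lt_succ_iff.1 (not_le.1 hi))
    exact ⟨by omega, fun h12 => by omega⟩

end Literature.Barriers.AtomisticToContinuum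

end
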